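import Literature.MathematicalPhysics.QuantumFieldTheory.Balaban1983to89.B6AgreeLapV1Chart

/-!
# `Balaban1983to89.B6FullWindowReachV1` — T. Bałaban, *Propagators and renormalization transformations for lattice gauge theories. II*, Commun.
# Math. Phys. **96** (1984) 223–250 [Balaban1984PropagatorsII], p. 238 («we take the cube □̃³ and identify it with a torus T_□») and (2.90)–(2.91),
# (2.133): THE FULL-PERIOD WINDOW SERVES BOTH THE INVERSION `(M_□ − P_□)G_□h_□ = h_□` AND THE (2.133) MAJORANT ON A CENTRAL REACH — item (d5-b)
# infrastructure of the B6 fold owner's programme for the genuine k-level Proposition 2.6 (B6-CLOSURE.md §5 items 9–11)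

statement-level skeleton of published theorems with citation tags; proofs where landed; nothing here is a claim about the Yang–Mills mass gap

WHY THIS FILE (finding F3 of the fold owner, 2026-08-23).  The assembled implication of record `B6GlobalChartV1.prop26_2136_V1_of_2134_eq291`
takes, per cube, ONE bond window `W c` for two roles: the inversion `hinvl : (Ml c − Pl c)·GlV1 (t c) hN (W c) (x₀ c)·h_c = h_c` — which holds for
the transplant of the genuine member ONLY through a BIJECTIVE window, i.e. the FULL period `2L^{m_□+K_□}` of `T_□` (`B6AgreeLapV1Chart.hinvl_GlV1`,
`B6Prop26ReachTransplant.hinv_of_bij`; a half window truncates `G_□ρh` before the non-local `P_□` acts) — and the (2.133) reach majorant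
`B6GlobalChartV1.reach2133_G_V1`, stated for windows of side `≤ L^{m_□+K_□}` (half the period, where the distance of `T_□` is the straight one).
This file reconciles the two: the transplant through the FULL window has the (2.133) `LocalMajorant` on every reach `S` whose bonds lie in a
half-period sub-window with the same corner (pairs inside `S` never see the far side of `T_□`), and the full-window `hinvl` survives the unit
scaling `(c′/L^j)²` of finding F1 (`hagree_member`).

PDF held: `paper:balaban1984-cmp96-propagators-rt-ii` (journal page = PDF page + 222); p. 238–239 [PDF 16–17], (2.133) p. 247 [PDF 25].

CITATION HEADER (lean-in-tree rule) — WHAT IS REPRODUCED.  Phase-2 file of the `lit-balaban` typed skeleton (HOME `run/shared/lean/pub/lit-balaban/`),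
unit `lit-balaban-r03` (B6 fold owner; r03 gen 19, literature-prover-lit-balaban-r03-g19-0), referee ref-4.  SKELETON rows **B6.Eq2.91** × **B6.Eq2.133**
× **B6.Prop2.6** (cells; decls of record untouched).  IMPORTS BY NAME, restating nothing: `B6Prop26ReachTransplant` (`restrictOp`, `transplant`,
`transplant_apply`, `chartBond`, `InWindow`), `B6Prop26Gluing.LocalMajorant`, `B6RandomWalk.BlockSupp`, `B6GlobalChartV1` (`GlV1`, `toBox`, `blkV1`,
**`reach2133_G_V1`**), `B6AgreeLapV1Chart` (`cB`, `DeepS`, `mem_cB_W`, `GlV1_eq`, `transplant_eB_eq`, `onFun_deltaA_mul_G`; cf. **`hinvl_GlV1`**), `B6Prop26ReachTransplant.hinv_of_bij`, `B6Geom246MultiLevelTorus.geomT`, `B6MultiLevelTorusOperator.TDomains`.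

THIS FILE (0 sorry; standard axioms; NO new definition, NO `def … : Prop`).
* §1 `restrictOp_eq_of_vanish` (a function vanishing on `W ∖ W′` restricts alike through `W` and `W′ ⊆ W`), `transplant_apply_eq_of_vanish`,
  **`localMajorant_transplant_of_subwindow`**: a `LocalMajorant` on a reach `S` of the transplant through `W′` IS one of the transplant through
  any `W ⊇ W′`, provided every bond whose block lies in `S` belongs to `W′` (the entries of a local majorant only involve inputs and outputs in `S`).
* §2 **`reach2133_G_V1_full`**: the constants `δ, A` of `reach2133_G_V1` serve the FULL-window `GlV1 t hN (cB t x₀ hx₀ hfit).W x₀` on every reach `S`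
  whose bonds lie in the half-period sub-window `[x₀, x₀ + Wd)`, `Wd ≤ L^{m_□+K_□}`, two-level, corner `x₀ ∈ L^jℤ^{d+1}` — the `h2133`-type input of
  the Prop. 2.6 chain for the SAME window that carries `hinvl`.
* §3 **`hinvl_GlV1_scaled`**: `(s•Ml − s•Pl)·(s⁻¹•GlV1)·h_□ = h_□` on the full window for every `s ≠ 0` (the member read in global units, F1).

HONEST SCOPE. (1) Nothing analytic is added: §2 is `reach2133_G_V1` moved to the full window by §1; the reach must sit in the LOWER sub-window
`[x₀, x₀ + Wd)` of the full window `[x₀, x₀ + 2L^{m_□+K_□})` (same corner as the chart), so a cube's `□̃³` is to be placed there with the margin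
`3L^{j+1}` of `B6AgreeQaQV1Chart` from the faces — the member torus of a cube is chosen large enough (its (2.133) constants are uniform in the size).
(2) The corrected k-level assembly itself ((d5-b): full windows, scaled members, P(y)-weighted chain) is NOT in this file.
Value = typed skeleton infrastructure removing an inconsistency between two hypotheses of the V1 assembly; NOT summit progress.
-/

noncomputable section

open scoped BigOperators
open Finset

namespace Literature.MathematicalPhysics.QuantumFieldTheory.Balaban1983to89.B6FullWindowReachV1

open B6Prop26Gluing (mulOp LocalMajorant)
open B6RandomWalk (BlockSupp)
open B6Prop26ReachTransplant (restrictOp transplant restrictOp_apply transplant_apply chartBond InWindow)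

/-! ## §1  A local majorant only sees the sub-window containing the reach -/

section Subwindow

variable {X X' : Type}

/-- a function vanishing on `W ∖ W′` is read alike through `W` and through `W′ ⊆ W`. [cite: Balaban1984PropagatorsII, p.238 (T_□ = □̃³), dictionary] -/
theorem restrictOp_eq_of_vanish [DecidableEq X'] (W W' : Finset X) (hW : W' ⊆ W) (e : X → X') (f : X → ℝ) (hf : ∀ x ∈ W, x ∉ W' → f x = 0) :
    restrictOp W e f = restrictOp W' e f := by
  funext x'
  rw [restrictOp_apply, restrictOp_apply]
  symm
  refine Finset.sum_subset (fun x hx => ?_) (fun x hx hx' => ?_)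
  · rw [Finset.mem_filter] at hx ⊢
    exact ⟨hW hx.1, hx.2⟩
  · rw [Finset.mem_filter] at hx hx'
    exact hf x hx.1 (fun h => hx' ⟨h, hx.2⟩)

/-- … hence so is its transplant at points of `W′`. [cite: Balaban1984PropagatorsII, p.238 (T_□ = □̃³), dictionary] -/
theorem transplant_apply_eq_of_vanish [DecidableEq X] [DecidableEq X'] (W W' : Finset X) (hW : W' ⊆ W) (e : X → X') (T' : Module.End ℝ (X' → ℝ)) (f : X → ℝ)
    (hf : ∀ x ∈ W, x ∉ W' → f x = 0) {x : X} (hx : x ∈ W') :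
    transplant W e T' f x = transplant W' e T' f x := by
  rw [transplant_apply, transplant_apply, if_pos (hW hx), if_pos hx, restrictOp_eq_of_vanish W W' hW e f hf]

/-- **A LOCAL MAJORANT ONLY SEES THE SUB-WINDOW CONTAINING THE REACH**: if every bond whose block lies in the reach `S` belongs to `W′ ⊆ W`,
a local majorant on `S` of the transplant through `W′` is one of the transplant through `W` (inputs supported in a block of `S` vanish off `W′`;
outputs are only read at bonds with block in `S`). [cite: Balaban1984PropagatorsII, (2.133) p.247, p.238 (T_□), dictionary] -/
theorem localMajorant_transplant_of_subwindow [DecidableEq X] [DecidableEq X'] {g : B6.Geometry} (blk : X → g.Site) (S : Set g.Site) (W W' : Finset X) (hW : W' ⊆ W)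
    (hS : ∀ x, blk x ∈ S → x ∈ W') (e : X → X') (T' : Module.End ℝ (X' → ℝ)) (K : g.Site → g.Site → ℝ)
    (h : LocalMajorant blk (transplant W' e T') S K) : LocalMajorant blk (transplant W e T') S K := by
  intro y' hy' μ B hμ x hx
  have hvan : ∀ z ∈ W, z ∉ W' → μ z = 0 := fun z _ hz => hμ.off z (fun hzy => hz (hS z (hzy ▸ hy')))
  rw [transplant_apply_eq_of_vanish W W' hW e T' μ hvan (hS x hx)]
  exact h y' hy' μ B hμ x hx

end Subwindow

/-! ## §2  The (2.133) reach majorant for the FULL-window transplant of `G_□` -/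

section Reach

open B6Prop25TwoScaleCensus (TSIdx)
open B6GlobalChartV1 (PV GlV1 toBox blkV1 reach2133_G_V1)
open B6MultiLevelBoxOperator (N0)
open B6MultiLevelTorusOperator (TDomains)
open B6Geom246MultiLevelTorus (geomT)
open B4Reflection242 (boxDom)
open B6AgreeLapV1Chart (cB DeepS mem_cB_W)

variable {d ℓ : ℕ}

/-- **(2.133) FOR THE FULL-WINDOW `GlV1` ON A CENTRAL REACH**: the constants `δ, A` of `B6GlobalChartV1.reach2133_G_V1` give, for every two-scale
member `t`, every V1 global torus whose fundamental box is the torus (`hN`), every corner `x₀ ≥ 0` with the full member period inside the box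
(`hfit`), `L^j ∣ x₀`, and every reach `S` all of whose bonds lie in the two-level half-period sub-window `[x₀, x₀ + Wd)`, `Wd ≤ L^{m_□+K_□}`:
`LocalMajorant (blkV1 hN D) (GlV1 t hN (cB t x₀ hx₀ hfit).W x₀) S (L^{d+1}·A·e^{2δ}·e^{−(δ/(d+1))·d_T})` — the window that carries `hinvl`.
[cite: Balaban1984PropagatorsII, (2.133) p.247, (2.90)–(2.91) p.239, p.238 (T_□ = □̃³)] -/
theorem reach2133_G_V1_full (d ℓ : ℕ) (hd : 1 ≤ d + 1) (hL : Odd (ℓ + 1) ∧ 1 < ℓ + 1) {a₀ a₁ : ℝ} (ha₀ : 0 < a₀) (ha₁ : a₀ ≤ a₁) :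
    ∃ δ : ℝ, 0 < δ ∧ ∃ A : ℝ, 0 ≤ A ∧ ∀ (t : TSIdx d (ℓ + 1) hd hL a₀ a₁) (m K : ℕ) {Mh k R : ℕ} {P' : Fin (d + 1) → ℕ}
      (hN : ∀ μ, N0 ℓ Mh k P' μ = (PV d ℓ m K hd hL).sitesPerDir 0) (D : TDomains d ℓ Mh k P' R) (_ : 1 ≤ Mh) (_ : ∀ μ, 1 ≤ P' μ)
      (x₀ : Fin (d + 1) → ℤ) (hx₀ : ∀ μ, 0 ≤ x₀ μ) (hfit : ∀ μ, x₀ μ + (t.P.sitesPerDir 0 : ℕ) ≤ ((PV d ℓ m K hd hL).sitesPerDir 0 : ℕ))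
      (_ : ∀ μ, (((ℓ + 1) ^ t.j : ℕ) : ℤ) ∣ x₀ μ) (Wd : ℕ) (_ : Wd ≤ (ℓ + 1) ^ (t.m + t.K))
      (_ : ∀ z ∈ boxDom (N0 ℓ Mh k P'), (∀ μ, x₀ μ ≤ z μ ∧ z μ < x₀ μ + Wd) → t.j ≤ D.lev z ∧ D.lev z ≤ t.j + 1)
      (S : Set (geomT D).Site)
      (_ : ∀ b : PBond (PV d ℓ m K hd hL) 0, blkV1 hN D b ∈ S →
        InWindow (fun b : PBond (PV d ℓ m K hd hL) 0 => (toBox hN b.src : Fin (d + 1) → ℤ)) x₀ Wd b),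
      LocalMajorant (g := geomT D) (blkV1 hN D) (GlV1 t hN (cB t x₀ hx₀ hfit).W x₀) S
        (fun a b => ((ℓ + 1) ^ (d + 1) : ℕ) * ((A * Real.exp (δ * ((d + 1 : ℝ) + (d + 1)) / (d + 1))) *
          Real.exp (-(δ / (d + 1) * (geomT D).dist a b)))) := by
  obtain ⟨δ, hδ, A, hA, h⟩ := reach2133_G_V1 d ℓ hd hL ha₀ ha₁
  refine ⟨δ, hδ, A, hA, fun t m K Mh k R P' hN D hMh hP x₀ hx₀ hfit hdiv Wd hWd hlev S hS => ?_⟩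
  classical
  -- the sub-window of the reach
  let W' : Finset (PBond (PV d ℓ m K hd hL) 0) :=
    (cB t x₀ hx₀ hfit).W.filter fun b => InWindow (fun b : PBond (PV d ℓ m K hd hL) 0 => (toBox hN b.src : Fin (d + 1) → ℤ)) x₀ Wd b
  have h' := h t m K hN D hMh hP x₀ hdiv Wd hWd hlev W' (fun b hb => (Finset.mem_filter.1 hb).2) S
  refine localMajorant_transplant_of_subwindow (blkV1 hN D) S (cB t x₀ hx₀ hfit).W W' (Finset.filter_subset _ _) (fun b hb => ?_) _ _ _ h'
  -- a bond of the sub-window is a bond of the full window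
  have hw := hS b hb
  refine Finset.mem_filter.2 ⟨mem_cB_W.2 fun μ => ?_, hw⟩
  obtain ⟨h1, h2⟩ := hw μ
  have hper : (ℓ + 1) ^ (t.m + t.K) < t.P.sitesPerDir 0 := by
    show (ℓ + 1) ^ (t.m + t.K) < 2 * (ℓ + 1) ^ (t.m + t.K - 0)
    have := Nat.one_le_pow (t.m + t.K) (ℓ + 1) (Nat.succ_pos ℓ)
    rw [Nat.sub_zero]; omega
  simp only [B6GlobalChartV1.toBox_apply] at h1 h2
  constructor <;> push_cast <;> omega

end Reach

/-! ## §3  The full-window inversion in global units -/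

section Scaled

open B6Prop25TwoScaleCensus (TSIdx)
open B6GlobalChartV1 (PV GlV1)
open B6MultiLevelBoxOperator (N0)
open B6Ineq2133TwoScaleV1 (onFun)
open B6AgreeLapV1Chart (cB eB posV GlV1_eq transplant_eB_eq onFun_deltaA_mul_G)
open B6Prop26ReachTransplant (hinv_of_bij)

variable {d ℓ : ℕ} {hd : 1 ≤ d + 1} {hL : Odd (ℓ + 1) ∧ 1 < ℓ + 1} {a₀ a₁ : ℝ} {m K : ℕ}
variable {t : TSIdx d (ℓ + 1) hd hL a₀ a₁} {x₀ : Fin (d + 1) → ℤ}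
variable {hx₀ : ∀ μ, 0 ≤ x₀ μ} {hfit : ∀ μ, x₀ μ + (t.P.sitesPerDir 0 : ℕ) ≤ ((PV d ℓ m K hd hL).sitesPerDir 0 : ℕ)}

/-- **`hinvl` IN GLOBAL UNITS**: with the member read in the units of the global torus — `Ml := s•ε(Δ_□ + Q*a_□Q)ρ`, `Pl := s•ε(∂P_□∂*)ρ`,
`Gl := s⁻¹•GlV1` on the full window, `s = (c′/L^j)² ≠ 0` (the rescaling (2.94)) — the inversion `(Ml − Pl)·Gl·h_□ = h_□` holds for every
window-supported `h_□`. [cite: Balaban1984PropagatorsII, (2.94) p.239, (2.90)–(2.91) p.239] -/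
theorem hinvl_GlV1_scaled (ha₀ : 0 < a₀) {Mh k : ℕ} {P' : Fin (d + 1) → ℕ} (hN : ∀ μ, N0 ℓ Mh k P' μ = (PV d ℓ m K hd hL).sitesPerDir 0)
    {s : ℝ} (hs : s ≠ 0) (h : PBond (PV d ℓ m K hd hL) 0 → ℝ) (hh : ∀ b, h b ≠ 0 → b ∈ (cB t x₀ hx₀ hfit).W) :
    (s • transplant (cB t x₀ hx₀ hfit).W (chartBond t posV PBond.dir x₀) (onFun (t.D.lapV + LinearMap.adjoint t.D.Q ∘ₗ t.D.a ∘ₗ t.D.Q)) -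
        s • transplant (cB t x₀ hx₀ hfit).W (chartBond t posV PBond.dir x₀) (onFun (t.D.grad ∘ₗ t.D.P ∘ₗ t.D.dv))) *
      (s⁻¹ • GlV1 t hN (cB t x₀ hx₀ hfit).W x₀) * mulOp h = mulOp h := by
  rw [GlV1_eq, ← transplant_eB_eq, ← transplant_eB_eq]
  exact hinv_of_bij (cB t x₀ hx₀ hfit).inj (cB t x₀ hx₀ hfit).surj (onFun_deltaA_mul_G ha₀ t) hs h hh

end Scaled

end Literature.MathematicalPhysics.QuantumFieldTheory.Balaban1983to89.B6FullWindowReachV1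

end
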